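import Literature.RepresentationTheory.MoeglinVignerasWaldspurger1987.RankOneThetaAnisotropicPlaneDichotomyCentre
import Literature.NumberTheory.Automorphic.Liu2021.LemD1RankTwoCMLetters
import Literature.NumberTheory.Automorphic.Liu2021.LemD1BinaryIsotropyOfPlace
import HarnessLib

/-!
# [Liu2021, Lem. D.1 (1)] at an ANISOTROPIC non-split place, rank-2 CM θ-package: EXACTLY ONE central character kills `ω(λ′_v, ε_{a′,v}, ·)`
# — the reading of ★ `rankOne_theta_anisotropicPlane_dichotomy` on the datum `localLemD1DataAtV₂` (step (R) of the L1ns road; unpinned)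

Topic `NumberTheory/Automorphic/Liu2021`; namespace `Literature.NumberTheory.Automorphic.Liu2021.Def411WeilCarriers` (that of ★ `LemD1Item1AtV2OfSplit`,
★ `LemD1Item1AtV2OfIsotropic`).  KERNEL: theorems only (no definition, no named fact, no `sorry`, no instance, no notation).  Cell hodgecm-mathlib, floor 0,
fan B rung B-IV, seat B-p04 (g43); `--supports stmt-HodgeConjecture-24832`.

WHY.  After ★ p849478 (isotropic places) and ★ p849507 (reduction), the booked letter L1ns ★ `LemD1RankTwoCMLetters.LemD1_1AsPrintedNonsplitCM₂` owes only its
item (1) at the ANISOTROPIC non-split places `v`: «`ω(μ_v, ε_v, χ_v) = 0 ↔ χ̌_v = μ_v²`».  ★ p849778∕p849816∕p849863 (`RankOneThetaAnisotropicPlaneDichotomy(Centre)`)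
prove the STRUCTURAL half for the plane `T₁ ⊕ a•T₁`: exactly one character of the centre `E_v¹` has vanishing theta lift.  This file reads that theorem on the
tree's datum `localLemD1DataAtV₂` (generic, then the CM θ-package of the letter) at ANY pair enumeration:

* §1 `gram_diagonal_units_TW_eq_finSum`, `TW_mul_eq_ratio_smul`, `units_enum_mul_eq` — bookkeeping of the plane `diag(t₀, t₁) ⊗ (a)` at ANY pair
  enumeration `e : Fin 2 × Fin 1 ≃ Fin 2`: `gram F e diag(t) (a) = (a t_{e⁻¹0}) ⊕ (a t_{e⁻¹1})` (the `hT` junction of ★ `…_centre`), the second line is the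
  `t_{e⁻¹1}/t_{e⁻¹0}`-multiple of the first, and `t_{e⁻¹0} t_{e⁻¹1} = t₀ t₁`;
* §2 GENERIC (any CM-type quadratic `E/F`, datum `localLemD1DataAtV₂ F E c 2 e J_V … a 𝓢 … χ v` over a diagonal frame `T_V = diag(t₀, t₁)`, any enumeration
  `e : Fin 2 × Fin 1 ≃ Fin n`): `exists_vanishing_localCharOfCenter_of_isField_of_hilbertSymbol` — at a place with `E_v` a field and `(d, −t₀t₁)_v = −1`
  there is `χ₀` (open kernel) on the centre line `U(J_W)(F_v)` with «datum's `χ_v`-quotient `= 0` ⟺ `localCharOfCenter … χ v = χ₀`» for EVERY `χ : Chi`;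
  `hilbertSymbol_eq_neg_one_of_isAnisotropic_localLemD1DataAtV₂` — the datum's `IsAnisotropic` gives `(d, −t₀t₁)_v = −1`;
  `exists_vanishing_localCharOfCenter_of_isField` — the same with the guard `(…).IsAnisotropic` per `χ`;
* §3 **the CM reading on the letter's binders** (`L`, `dV`, `e₁ : Fin 2 × Fin 1 ≃ Fin n'`, `a′`, `λ′`, `v` non-split):
  `isField_localRing_cm_of_forall_smul_eq`, **`exists_vanishing_localCharOfCenter_cm_of_hilbertSymbol`**, **`exists_vanishing_localCharOfCenter_cm_of_isAnisotropic`** —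
  there is a character `χ₀` of `U(J_W)(L⁺_v)` (`J_W = (a′)`) with open kernel such that for EVERY central character `χ : Chi` (at which the datum is anisotropic),
  «`ω(λ′_v, ε_{a′,v}, χ_v) = 0` (`Subsingleton` of the datum's quotient) ⟺ `localCharOfCenter … χ v = χ₀`».

So at an anisotropic non-split place the vanishing clause of [Lem. D.1 (1)] holds for exactly one local central character; what the letter still owes is the
IDENTIFICATION `χ₀ ↔ «χ̌_v = μ_v²»` (the (P) step).  HC_CM is proved only modulo the printed citations — the 2 remaining named inputs (hLiu418 = stmt-HodgeConjecture-24832,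
h413 = 24833) — until rung 0 closes; count-neutral.

## References
* [Liu2021] Y. Liu, Camb. J. Math. 9 (2021) = arXiv:2102.11518, App. D Lemma D.1 (1) (p. 125, l. 5226–5229); proof l. 5245 (p. 126).
* [MoeglinVignerasWaldspurger1987] LNM 1291 (1987), Chap. 3 §IV.2, §IV.4 Théorème principal.
* [HarrisKudlaSweet1996] M. Harris, S. Kudla, W. J. Sweet, J. AMS 9 (1996), Prop. 5.1 (iii), Thm. 6.1.
* [Omeara1963] O. T. O'Meara, *Introduction to quadratic forms* (1963), §63B.
-/

set_option autoImplicit false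

noncomputable section

open scoped Matrix Kronecker TensorProduct Classical RestrictedProduct
open NumberField IsDedekindDomain Filter Set
open _root_.MeasureTheory
open Literature.NumberTheory Literature.NumberTheory.Automorphic Literature.NumberTheory.Automorphic.UnitaryGroup
open Literature.NumberTheory.Weil1964 Literature.RepresentationTheory
open Literature.RepresentationTheory.HeisenbergGroup
open Literature.RepresentationTheory.Liu2021 (OscillatorStandingData)
open Literature.RepresentationTheory.CentralCharacterQuotient (augmentation)
open Literature.RepresentationTheory.MoeglinVignerasWaldspurger1987
open Literature.NumberTheory.QuadraticForms (hilbertSymbol)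

/-! ## §1 Bookkeeping of the plane `diag(t₀, t₁) ⊗ (a)`: Gram block sum, the ratio of the two lines -/

namespace Literature.NumberTheory.Automorphic.Liu2021.Def411WeilCarriers

open Literature.NumberTheory.GelbartRogawski1991 Literature.NumberTheory.GelbartRogawski1991.UnitaryDualPair
open Literature.NumberTheory.GelbartRogawski1991.UnitaryDualPair.WeilCoinv
open Literature.NumberTheory.GelbartRogawski1991.UnitaryDualPair.LocalSplitting

/-- **`gram F e (diag t) (a) = (a·t_{e⁻¹0}) ⊕ (a·t_{e⁻¹1})`**: at ANY pair enumeration `e : Fin 2 × Fin 1 ≃ Fin 2` the Gram matrix of `(diag(t₀, t₁), ⟨a⟩)` is the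
block sum (`UnitaryGroup.finSum 1 1`; `Fin (1 + 1) = Fin 2`) of the two hermitian LINES `(a·t_{(e⁻¹ 0)₁})`, `(a·t_{(e⁻¹ 1)₁})` (★ `gram_diagonal_TW`).
[cite: GelbartRogawski1991, §3.1 p. 454] -/
theorem gram_diagonal_units_TW_eq_finSum (F : Type) [Field F] [NumberField F] (e : Fin 2 × Fin 1 ≃ Fin 2) (t : Fin 2 → Fˣ) (a : Fˣ) :
    gram F e (Matrix.diagonal fun i => (t i : F)) (TW F a) =
      UnitaryGroup.finSum 1 1 (TW F (a * t (e.symm 0).1)) (TW F (a * t (e.symm 1).1)) := by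
  -- `gram e (diag t) (a) = diag(k ↦ t_{(e⁻¹ k)₁} · a)` (the computation of ★ `LocalSplitting.gram_diagonal_TW`, entrywise)
  have hTW : ∀ (i' j' : Fin 1), TW F a i' j' = (a : F) := fun i' j' => by
    rw [Subsingleton.elim i' 0, Subsingleton.elim j' 0]; rfl
  have hdiag : gram F e (Matrix.diagonal fun i => (t i : F)) (TW F a) = Matrix.diagonal fun k => (t (e.symm k).1 : F) * (a : F) := by
    refine Matrix.ext fun i j => ?_
    change ((Matrix.diagonal fun i => (t i : F)) ⊗ₖ TW F a) (e.symm i) (e.symm j) = Matrix.diagonal (fun k => (t (e.symm k).1 : F) * (a : F)) i j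
    rw [Matrix.kroneckerMap_apply, hTW]
    by_cases h : i = j
    · subst h
      rw [Matrix.diagonal_apply_eq, Matrix.diagonal_apply_eq]
    · have h1 : (e.symm i).1 ≠ (e.symm j).1 := fun h1 => h (e.symm.injective (Prod.ext h1 (Subsingleton.elim _ _)))
      rw [Matrix.diagonal_apply_ne _ h1, Matrix.diagonal_apply_ne _ h, zero_mul]
  rw [hdiag]
  refine Matrix.ext fun i j => ?_
  fin_cases i <;> fin_cases j <;>
    simp [UnitaryGroup.finSum, TW, Matrix.fromBlocks, Matrix.diagonal, finSumFinEquiv, Fin.addCases, Matrix.of_apply, mul_comm]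

/-- the second line is the `t₁/t₀`-multiple of the first: `(a t₁) = (t₁ t₀⁻¹) • (a t₀)`. [cite: GelbartRogawski1991, §3.1 p. 454] -/
theorem TW_mul_eq_ratio_smul (F : Type) [Field F] (a t₀ t₁ : Fˣ) :
    TW F (a * t₁) = ((t₁ * t₀⁻¹ : Fˣ) : F) • TW F (a * t₀) := by
  refine Matrix.ext fun i j => ?_
  rw [Subsingleton.elim i 0, Subsingleton.elim j 0]
  change ((a * t₁ : Fˣ) : F) = ((t₁ * t₀⁻¹ : Fˣ) : F) • ((a * t₀ : Fˣ) : F)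
  rw [smul_eq_mul, ← Units.val_mul]
  congr 1
  rw [mul_mul_mul_comm, inv_mul_cancel, mul_one, mul_comm]

/-- the two line entries read off an enumeration have the same product as the frame: `t_{(e⁻¹0)₁} · t_{(e⁻¹1)₁} = t₀ t₁` (`k ↦ (e⁻¹ k)₁` is a
permutation of `Fin 2`). [cite: GelbartRogawski1991, §3.1 p. 454] -/
theorem units_enum_mul_eq (F : Type) [Field F] (e : Fin 2 × Fin 1 ≃ Fin 2) (t : Fin 2 → Fˣ) :
    (t (e.symm 0).1 : F) * t (e.symm 1).1 = t 0 * t 1 := by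
  have h := Equiv.prod_comp (e.symm.trans (Equiv.prodUnique (Fin 2) (Fin 1))) (fun i => (t i : F))
  simpa only [Fin.prod_univ_two, Equiv.trans_apply, Equiv.prodUnique_apply] using h

/-! ## §2 GENERIC: at a non-split place with `(d, −t₀t₁)_v = −1`, exactly one central character kills the `χ_v`-quotient of `localLemD1DataAtV₂` -/

section AtV

variable (F E : Type) [Field F] [NumberField F] [Field E] [NumberField E] [Algebra F E]
variable (c : E ≃ₐ[F] E) {n : ℕ} (e : Fin 2 × Fin 1 ≃ Fin n)
variable (JV : Matrix (Fin 2) (Fin 2) E) {TV : Matrix (Fin 2) (Fin 2) F}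
variable [Algebra.IsQuadraticExtension F E] {δ : E} (hcδ : c δ = -δ) (hδ : δ ≠ 0) {d : F} (hd : δ * δ = algebraMap F E d)

/-- **[Liu2021, Lem. D.1 (1)] at an ANISOTROPIC NON-SPLIT place — EXACTLY ONE vanishing central character (unpinned), GENERIC datum.**
For the rank-2 datum `localLemD1DataAtV₂ F E c 2 e J_V … a 𝓢 … χ v` over a real DIAGONAL frame `T_V = diag(t₀, t₁)` (`hTV`), any pair enumeration
`e : Fin 2 × Fin 1 ≃ Fin n`, at a place `v` with `E_v` a FIELD (`hf`) and `(d, −t₀t₁)_v = −1` (`hH`: the plane `V_v` is anisotropic,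
★ `not_isIsotropic_standingData_iff_hilbertSymbol_eq_neg_one`), there is a character `χ₀` of the centre line `U(J_W)(F_v)` (`J_W = (a)`) with open kernel
such that for EVERY `χ : Chi`: the datum's `χ_v`-quotient is zero (`Subsingleton`) `⟺ localCharOfCenter … χ v = χ₀`.  Proof: `n = 2`
(`Fintype.card_congr e`); `gram F e T_V (a) = (a t_{e⁻¹0}) ⊕ (a t_{e⁻¹1})` (§1) is the plane `T₁ ⊕ b•T₁`, `b = t_{e⁻¹1}/t_{e⁻¹0}`, with
`(−b⁻¹, d)_v = (d, −t₀t₁·(t_{e⁻¹1}⁻¹)²)_v = −1`; ★ `rankOne_theta_anisotropicPlane_dichotomy_centre` at the smooth section `𝓢.s v` over `ι_v`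
(`𝓢.omegaLoc v = toRep ∘ 𝓢.s v` by `rfl`) and the centre line `J_W`, on the unitary continuous `χ_v`; junction to the datum's quotient ★ `quotEquivLocalType₂`.
[cite: Liu2021, App. D Lemma D.1 (1) (p. 125, l. 5229); proof l. 5245 (p. 126)]
[cite: MoeglinVignerasWaldspurger1987, Chap. 3 §IV.4 Théorème principal; §IV.2] [cite: HarrisKudlaSweet1996, Prop. 5.1 (iii)] -/
theorem exists_vanishing_localCharOfCenter_of_isField_of_hilbertSymbol (hV : TV.IsSymm) (hVd : IsUnit TV.det)
    (hJV : JV = TV.map (algebraMap F E)) (t : Fin 2 → Fˣ) (hTV : TV = Matrix.diagonal fun i => (t i : F)) (a : Fˣ)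
    (𝓢 : LocalSplitting.FinLocalSplittings F E c n hcδ hδ hd (gram F e TV (TW F a)) (isSymm_gram F e hV (isSymm_TW F a))
      (reindex_kronecker_eq_gram_map F E e hJV (JW_eq F E a)))
    (hn : 2 ≤ n) (μ : ∀ v : HeightOneSpectrum (𝓞 F), (LocalRing E v)ˣ →* ℂˣ) (hμn : ∀ v x, ‖((μ v x : ℂˣ) : ℂ)‖ = 1)
    (hμc : ∀ v, Continuous fun x => ((μ v x : ℂˣ) : ℂ))
    (hμF : ∀ (v : HeightOneSpectrum (𝓞 F)) (t : (v.adicCompletion F)ˣ),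
      μ v (Units.map (algebraMap (v.adicCompletion F) (LocalRing E v)).toMonoidHom t) = 1 ↔
        ∃ x : (LocalRing E v)ˣ, (x : LocalRing E v) * conjLocal E c v x = algebraMap (v.adicCompletion F) (LocalRing E v) t)
    (v : HeightOneSpectrum (𝓞 F)) (hf : IsField (LocalRing E v))
    (hH : hilbertSymbol (v.adicCompletion F) (algebraMap F _ d) (algebraMap F _ (-((t 0 : F) * (t 1 : F)))) = -1) :
    ∃ χ₀ : localPi E c 1 (JW F E a) v →* ℂˣ, IsOpen (χ₀.ker : Set (localPi E c 1 (JW F E a) v)) ∧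
      ∀ χ : Chi F E c,
        (Subsingleton (SchwartzBruhat (Fin n → v.adicCompletion F) ⧸
            augmentation (localLemD1DataAtV₂ F E c 2 e JV hcδ hδ hd hV hVd hJV a 𝓢 hn μ hμn hμc hμF χ v).omega
              (localLemD1DataAtV₂ F E c 2 e JV hcδ hδ hd hV hVd hJV a 𝓢 hn μ hμn hμc hμF χ v).S.scalar (localLemD1DataAtV₂ F E c 2 e JV hcδ hδ hd hV hVd hJV a 𝓢 hn μ hμn hμc hμF χ v).chi) ↔
          localCharOfCenter F E c (JW F E a) (JW_apply_ne_zero F E a) χ.1 v = χ₀) := by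
  -- `n = 2`, `T_V = diag(t)`
  obtain rfl : n = 2 := by
    have h := Fintype.card_congr e
    simp only [Fintype.card_prod, Fintype.card_fin, mul_one] at h
    omega
  subst hTV
  -- the plane `(a t_{e⁻¹0}) ⊕ (a t_{e⁻¹1})` and its class
  have hT := gram_diagonal_units_TW_eq_finSum F e t a
  have hTT' := TW_mul_eq_ratio_smul F a (t (e.symm 0).1) (t (e.symm 1).1)
  have hclass : hilbertSymbol (v.adicCompletion F) ((-((t (e.symm 1).1 * (t (e.symm 0).1)⁻¹ : Fˣ) : F)⁻¹ : F) : v.adicCompletion F)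
      ((d : F) : v.adicCompletion F) = -1 := by
    have h0 : ((t (e.symm 1).1 : Fˣ) : F) ≠ 0 := (t (e.symm 1).1).ne_zero
    have hx : (-((t (e.symm 1).1 * (t (e.symm 0).1)⁻¹ : Fˣ) : F)⁻¹ : F) =
        -((t 0 : F) * (t 1 : F)) * (((t (e.symm 1).1 : F))⁻¹) ^ 2 := by
      rw [← units_enum_mul_eq F e t, Units.val_mul, Units.val_inv_eq_inv_val]
      field_simp
    have hx' : ((-((t (e.symm 1).1 * (t (e.symm 0).1)⁻¹ : Fˣ) : F)⁻¹ : F) : v.adicCompletion F) =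
        algebraMap F (v.adicCompletion F) (-((t 0 : F) * (t 1 : F))) * (algebraMap F (v.adicCompletion F) ((t (e.symm 1).1 : F)⁻¹)) ^ 2 := by
      rw [← map_pow, ← map_mul, ← hx]; rfl
    rw [Literature.NumberTheory.QuadraticForms.hilbertSymbol_comm, hx',
      Literature.NumberTheory.QuadraticForms.hilbertSymbol_mul_sq_right _ _ ((map_ne_zero _).2 (inv_ne_zero h0))]
    exact hH
  -- ★ the structural dichotomy, centre embedded through `J_W = (a)`
  obtain ⟨χ₀, hχ₀o, hmain⟩ := rankOne_theta_anisotropicPlane_dichotomy_centre F E c hcδ hδ hd v (isSymm_TW F (a * t (e.symm 0).1))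
    (isSymm_TW F (a * t (e.symm 1).1)) (isUnit_det_TW F (a * t (e.symm 0).1)) (isUnit_det_TW F (a * t (e.symm 1).1))
    (t (e.symm 1).1 * (t (e.symm 0).1)⁻¹) hTT' (JW_eq F E (a * t (e.symm 0).1)) (JW_eq F E (a * t (e.symm 1).1)) hT
    (isSymm_gram F e hV (isSymm_TW F a)) (reindex_kronecker_eq_gram_map F E e hJV (JW_eq F E a)) (𝓢.s v) (𝓢.proj_s v)
    (JW_apply_ne_zero F E (a * t (e.symm 0).1)) (JW_apply_ne_zero F E a) hf (𝓢.smooth v) hclass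
  refine ⟨χ₀, hχ₀o, fun χ => ?_⟩
  -- junction to the datum's quotient, on the unitary continuous `χ_v`
  have hq := (quotEquivLocalType₂ F E c 2 e JV hcδ hδ hd hV hVd hJV a 𝓢 hn μ hμn hμc hμF χ v).toLinearEquiv.toEquiv.nontrivial_congr
  have hχ := hmain (localCharOfCenter F E c (JW F E a) (JW_apply_ne_zero F E a) χ.1 v)
    (norm_localCharOfCenter F E c (JW F E a) (JW_apply_ne_zero F E a)
      (norm_chi_eq_one F E c (Algebra.IsQuadraticExtension.finrank_eq_two F E) (UnitaryGroup.algEquiv_ne_one_of_apply_eq_neg F E c hcδ hδ) χ) v)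
    (continuous_coe_localCharOfCenter F E c (JW F E a) (JW_apply_ne_zero F E a) χ.2.1 v)
  refine ⟨fun hs => by_contra fun hne => (not_nontrivial_iff_subsingleton.2 hs) (hq.2 (hχ.2 hne)), fun heq => ?_⟩
  rcases subsingleton_or_nontrivial (SchwartzBruhat (Fin 2 → v.adicCompletion F) ⧸
      augmentation (localLemD1DataAtV₂ F E c 2 e JV hcδ hδ hd hV hVd hJV a 𝓢 hn μ hμn hμc hμF χ v).omega
        (localLemD1DataAtV₂ F E c 2 e JV hcδ hδ hd hV hVd hJV a 𝓢 hn μ hμn hμc hμF χ v).S.scalar (localLemD1DataAtV₂ F E c 2 e JV hcδ hδ hd hV hVd hJV a 𝓢 hn μ hμn hμc hμF χ v).chi) with h | h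
  · exact h
  · exact absurd heq (hχ.1 (hq.1 h))

/-- **anisotropy of the rank-2 datum in Hilbert-symbol currency**: for the datum over the diagonal frame `diag(t₀, t₁)`, `(…).IsAnisotropic` (a `χ`-free
condition on its standing data) gives `(d, −t₀t₁)_v = −1` (★ `LemD1Data.isAnisotropic_iff_not_isIsotropic`, ★ `not_isIsotropic_standingData_iff_hilbertSymbol_eq_neg_one`).
[cite: Liu2021, App. D Lemma D.1 (1) (p. 125, l. 5229)] [cite: Omeara1963, §63B] -/
theorem hilbertSymbol_eq_neg_one_of_isAnisotropic_localLemD1DataAtV₂ (hV : TV.IsSymm) (hVd : IsUnit TV.det)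
    (hJV : JV = TV.map (algebraMap F E)) (t : Fin 2 → Fˣ) (hTV : TV = Matrix.diagonal fun i => (t i : F)) (a : Fˣ)
    (𝓢 : LocalSplitting.FinLocalSplittings F E c n hcδ hδ hd (gram F e TV (TW F a)) (isSymm_gram F e hV (isSymm_TW F a))
      (reindex_kronecker_eq_gram_map F E e hJV (JW_eq F E a)))
    (hn : 2 ≤ n) (μ : ∀ v : HeightOneSpectrum (𝓞 F), (LocalRing E v)ˣ →* ℂˣ) (hμn : ∀ v x, ‖((μ v x : ℂˣ) : ℂ)‖ = 1)
    (hμc : ∀ v, Continuous fun x => ((μ v x : ℂˣ) : ℂ))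
    (hμF : ∀ (v : HeightOneSpectrum (𝓞 F)) (t : (v.adicCompletion F)ˣ),
      μ v (Units.map (algebraMap (v.adicCompletion F) (LocalRing E v)).toMonoidHom t) = 1 ↔
        ∃ x : (LocalRing E v)ˣ, (x : LocalRing E v) * conjLocal E c v x = algebraMap (v.adicCompletion F) (LocalRing E v) t)
    (χ : Chi F E c) (v : HeightOneSpectrum (𝓞 F))
    (hani : (localLemD1DataAtV₂ F E c 2 e JV hcδ hδ hd hV hVd hJV a 𝓢 hn μ hμn hμc hμF χ v).IsAnisotropic) :
    hilbertSymbol (v.adicCompletion F) (algebraMap F _ d) (algebraMap F _ (-((t 0 : F) * (t 1 : F)))) = -1 := by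
  have hJ' : JV = (Matrix.diagonal fun i => (t i : F)).map (algebraMap F E) := by rw [hJV, hTV]
  -- `(…).IsAnisotropic` is `¬ IsIsotropic (…).S` (★), and `(…).S` IS the standing data of `(E_v², J_V)` (`dsimp` unfolds the record)
  have hnot := (LemD1Data.isAnisotropic_iff_not_isIsotropic _).1 hani
  dsimp only [localLemD1DataAtV₂] at hnot
  exact (LemD1OfPlace.not_isIsotropic_standingData_iff_hilbertSymbol_eq_neg_one E v c hcδ hδ (fun i => (t i : F)) hJ' _ _ hd
    (fun i => (t i).ne_zero)).1 hnot

/-- **[Liu2021, Lem. D.1 (1)] at an ANISOTROPIC NON-SPLIT place — EXACTLY ONE vanishing central character (unpinned), GENERIC datum, the guard in the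
datum's own currency**: at a place `v` with `E_v` a field there is `χ₀` (open kernel) on the centre line `U(J_W)(F_v)` such that for every `χ : Chi` at
which the datum is ANISOTROPIC (a `χ`-free condition), its `χ_v`-quotient is zero `⟺ localCharOfCenter … χ v = χ₀`
(`exists_vanishing_localCharOfCenter_of_isField_of_hilbertSymbol` when `(d, −t₀t₁)_v = −1`; otherwise the guard is void by
`hilbertSymbol_eq_neg_one_of_isAnisotropic_localLemD1DataAtV₂`).
[cite: Liu2021, App. D Lemma D.1 (1) (p. 125, l. 5229); proof l. 5245 (p. 126)] [cite: MoeglinVignerasWaldspurger1987, Chap. 3 §IV.4 Théorème principal] -/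
theorem exists_vanishing_localCharOfCenter_of_isField (hV : TV.IsSymm) (hVd : IsUnit TV.det)
    (hJV : JV = TV.map (algebraMap F E)) (t : Fin 2 → Fˣ) (hTV : TV = Matrix.diagonal fun i => (t i : F)) (a : Fˣ)
    (𝓢 : LocalSplitting.FinLocalSplittings F E c n hcδ hδ hd (gram F e TV (TW F a)) (isSymm_gram F e hV (isSymm_TW F a))
      (reindex_kronecker_eq_gram_map F E e hJV (JW_eq F E a)))
    (hn : 2 ≤ n) (μ : ∀ v : HeightOneSpectrum (𝓞 F), (LocalRing E v)ˣ →* ℂˣ) (hμn : ∀ v x, ‖((μ v x : ℂˣ) : ℂ)‖ = 1)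
    (hμc : ∀ v, Continuous fun x => ((μ v x : ℂˣ) : ℂ))
    (hμF : ∀ (v : HeightOneSpectrum (𝓞 F)) (t : (v.adicCompletion F)ˣ),
      μ v (Units.map (algebraMap (v.adicCompletion F) (LocalRing E v)).toMonoidHom t) = 1 ↔
        ∃ x : (LocalRing E v)ˣ, (x : LocalRing E v) * conjLocal E c v x = algebraMap (v.adicCompletion F) (LocalRing E v) t)
    (v : HeightOneSpectrum (𝓞 F)) (hf : IsField (LocalRing E v)) :
    ∃ χ₀ : localPi E c 1 (JW F E a) v →* ℂˣ, IsOpen (χ₀.ker : Set (localPi E c 1 (JW F E a) v)) ∧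
      ∀ χ : Chi F E c, (localLemD1DataAtV₂ F E c 2 e JV hcδ hδ hd hV hVd hJV a 𝓢 hn μ hμn hμc hμF χ v).IsAnisotropic →
        (Subsingleton (SchwartzBruhat (Fin n → v.adicCompletion F) ⧸
            augmentation (localLemD1DataAtV₂ F E c 2 e JV hcδ hδ hd hV hVd hJV a 𝓢 hn μ hμn hμc hμF χ v).omega
              (localLemD1DataAtV₂ F E c 2 e JV hcδ hδ hd hV hVd hJV a 𝓢 hn μ hμn hμc hμF χ v).S.scalar (localLemD1DataAtV₂ F E c 2 e JV hcδ hδ hd hV hVd hJV a 𝓢 hn μ hμn hμc hμF χ v).chi) ↔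
          localCharOfCenter F E c (JW F E a) (JW_apply_ne_zero F E a) χ.1 v = χ₀) := by
  by_cases hH : hilbertSymbol (v.adicCompletion F) (algebraMap F _ d) (algebraMap F _ (-((t 0 : F) * (t 1 : F)))) = -1
  · obtain ⟨χ₀, h₁, h₂⟩ := exists_vanishing_localCharOfCenter_of_isField_of_hilbertSymbol F E c e JV hcδ hδ hd hV hVd hJV t hTV a 𝓢 hn μ
      hμn hμc hμF v hf hH
    exact ⟨χ₀, h₁, fun χ _ => h₂ χ⟩
  · refine ⟨1, ?_, fun χ hani =>
      absurd (hilbertSymbol_eq_neg_one_of_isAnisotropic_localLemD1DataAtV₂ F E c e JV hcδ hδ hd hV hVd hJV t hTV a 𝓢 hn μ hμn hμc hμF χ v hani) hH⟩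
    simp only [MonoidHom.ker_one, Subgroup.coe_top]
    exact isOpen_univ

end AtV

/-! ## §3 The reading on the rank-2 CM θ-package of the letter ★ `LemD1RankTwoCMLetters.LemD1_1AsPrintedNonsplitCM₂` at an ANISOTROPIC non-split place -/

section CM

open NumberField.mixedEmbedding NumberField.InfinitePlace
open Literature.NumberTheory.GaloisRepresentations Literature.RepresentationTheory.HarrisKudlaSweet1996
open Literature.NumberTheory.Automorphic.IdeleClassGroup Literature.RepresentationTheory.Liu2021
open Literature.NumberTheory.Automorphic.Liu2021.Def411WeilCarriersDoubling
open Literature.NumberTheory.GelbartRogawski1991.GRConstruction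

/-- `L_v` is a field at a place of `L⁺` non-split in `L` (contrapositive of ★ `SplitPlace.exists_placesOver_smul_ne_of_not_isField`).
[cite: GelbartRogawski1991, §3.2 p. 457] -/
theorem isField_localRing_cm_of_forall_smul_eq (L : Type) [Field L] [NumberField L] [IsCMField L]
    (v : HeightOneSpectrum (𝓞 ↥(maximalRealSubfield L)))
    (hv : ∀ w : UnitaryGroup.PlacesOver L v, IsCMField.complexConj L • (w : HeightOneSpectrum (𝓞 L)) = w) :
    IsField (LocalRing L v) := by
  by_contra h
  obtain ⟨w, hw⟩ := SplitPlace.exists_placesOver_smul_ne_of_not_isField L v (IsCMField.complexConj L)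
    (UnitaryGroup.algEquiv_ne_one_of_apply_eq_neg (Fp L) L (IsCMField.complexConj L) (complexConj_imagUnit L) (imagUnit_ne_zero L)) h
  exact hw (hv w)

-- unifying the letter's CM package terms with §2's generic binders: 2× the default budget
set_option maxHeartbeats 400000 in
/-- **[Liu2021, Lem. D.1 (1)] on the rank-2 CM θ-package at a NON-SPLIT place with `(δ², −dV₀dV₁)_v = −1` — EXACTLY ONE vanishing central character.**
For every CM field `L`, real non-zero frame `dV : Fin 2 → L`, pair enumeration `e₁`, line `a′`, conjugate-symplectic `λ′` and finite place `v` of `L⁺`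
NON-SPLIT in `L` with `(δ², −dV₀dV₁)_v = −1` (the plane `V_v` anisotropic): there is a character `χ₀` of `U(J_W)(L⁺_v)` (`J_W = (a′)`) with open kernel such that
for EVERY `χ : Chi`, «`ω(λ′_v, ε_{a′,v}, χ_v) = 0` (the `χ_v`-quotient of `localLemD1DataAtV₂ (Fp L) L … a′ 𝓢_{λ′,a′} … χ v` is `Subsingleton`)
`⟺ localCharOfCenter … χ v = χ₀`» (§2 on the letter's binders; `L_v` a field by `isField_localRing_cm_of_forall_smul_eq`).
[cite: Liu2021, App. D Lemma D.1 (1) (p. 125, l. 5229); proof l. 5245 (p. 126)] [cite: MoeglinVignerasWaldspurger1987, Chap. 3 §IV.4 Théorème principal] -/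
theorem exists_vanishing_localCharOfCenter_cm_of_hilbertSymbol
    (L : Type) [Field L] [NumberField L] [IsCMField L]
      (dV : Fin 2 → L) (hdV : ∀ i, IsCMField.complexConj L (dV i) = dV i) (hdV0 : ∀ i, dV i ≠ 0)
      {n' : ℕ} (e₁ : Fin 2 × Fin 1 ≃ Fin n') (a' : (↥(maximalRealSubfield L))ˣ)
      (lam' : Literature.NumberTheory.Automorphic.IdeleClassGroup L →ₜ* Circle) (hlam' : IsConjugateSymplectic L lam')
      (v : HeightOneSpectrum (𝓞 ↥(maximalRealSubfield L)))
    (hv : ∀ w : UnitaryGroup.PlacesOver L v, IsCMField.complexConj L • (w : HeightOneSpectrum (𝓞 L)) = w)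
    (hH : hilbertSymbol (v.adicCompletion (Fp L)) (algebraMap (Fp L) _ (imagUnitSq L))
      (algebraMap (Fp L) _ (-((⟨dV 0, (IsCMField.complexConj_eq_self_iff (K := L) (dV 0)).1 (hdV 0)⟩ : Fp L) * (⟨dV 1, (IsCMField.complexConj_eq_self_iff (K := L) (dV 1)).1 (hdV 1)⟩ : Fp L)))) = -1) :
    ∃ χ₀ : UnitaryGroup.localPi L (IsCMField.complexConj L) 1 (JW (Fp L) L a') v →* ℂˣ,
      IsOpen (χ₀.ker : Set (UnitaryGroup.localPi L (IsCMField.complexConj L) 1 (JW (Fp L) L a') v)) ∧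
      ∀ χ : Chi (↥(maximalRealSubfield L)) L (IsCMField.complexConj L),
        (Subsingleton (SchwartzBruhat (Fin n' → v.adicCompletion (Fp L)) ⧸
            augmentation (localLemD1DataAtV₂ (Fp L) L (IsCMField.complexConj L) 2 e₁ (Matrix.diagonal dV) (complexConj_imagUnit L)
        (imagUnit_ne_zero L) (imagUnit_mul_self L) (realDiagonal_isSymm L dV hdV) (isUnit_det_realDiagonal L dV hdV hdV0)
        (realDiagonal_map L dV hdV).symm a' (congrW L e₁ dV hdV (lineW L (TW (Fp L) a')) (complexConj_lineW L (TW (Fp L) a')) (realDiagonal_lineW L (TW (Fp L) a')) (diagonal_lineW L (TW (Fp L) a') (JW_eq (Fp L) L a')) (undoubledSplittings L e₁ dV hdV hdV0 (lineW L (TW (Fp L) a')) (complexConj_lineW L (TW (Fp L) a')) (lineW_ne_zero L (TW (Fp L) a') (isUnit_det_TW (Fp L) a')) (toHeckeCharacter L lam') (borelPlaceMeasure L) (cmFinLocalFamily L e₁ dV hdV hdV0 (lineW L (TW (Fp L) a')) (complexConj_lineW L (TW (Fp L) a')) (lineW_ne_zero L (TW (Fp L) a') (isUnit_det_TW (Fp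 L) a')) (toHeckeCharacter L lam') ((isOscillatorChar_toHeckeCharacter_iff lam').mpr hlam') (borelPlaceMeasure L))) (isSymm_TW (Fp L) a') (JW_eq (Fp L) L a')) (by -- `2 ≤ n'` (§D.1 «rank n ≥ 2»); the assembler's proof argument here is `two_le_of_finTwo_equiv e₁`
          have h := Fintype.card_congr e₁
          simp only [Fintype.card_prod, Fintype.card_fin, mul_one] at h
          omega)
        (localMu L (toHeckeCharacter L lam')) (fun v x => norm_localMu L (toHeckeCharacter L lam') v (isUnitary_toHeckeCharacter L lam') x)
        (continuous_localMu L (toHeckeCharacter L lam'))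
        (fun v t => localMu_toLocalRing_eq_one_iff L (toHeckeCharacter L lam') v ((isOscillatorChar_toHeckeCharacter_iff lam').mpr hlam') t)
        χ v).omega
              (localLemD1DataAtV₂ (Fp L) L (IsCMField.complexConj L) 2 e₁ (Matrix.diagonal dV) (complexConj_imagUnit L)
        (imagUnit_ne_zero L) (imagUnit_mul_self L) (realDiagonal_isSymm L dV hdV) (isUnit_det_realDiagonal L dV hdV hdV0)
        (realDiagonal_map L dV hdV).symm a' (congrW L e₁ dV hdV (lineW L (TW (Fp L) a')) (complexConj_lineW L (TW (Fp L) a')) (realDiagonal_lineW L (TW (Fp L) a')) (diagonal_lineW L (TW (Fp L) a') (JW_eq (Fp L) L a')) (undoubledSplittings L e₁ dV hdV hdV0 (lineW L (TW (Fp L) a')) (complexConj_lineW L (TW (Fp L) a')) (lineW_ne_zero L (TW (Fp L) a') (isUnit_det_TW (Fp L) a')) (toHeckeCharacter L lam') (borelPlaceMeasure L) (cmFinLocalFamily L e₁ dV hdV hdV0 (lineW L (TW (Fp L) a')) (complexConj_lineW L (TW (Fp L) a')) (lineW_ne_zero L (TW (Fp L) a') (isUnit_det_TW (Fp L) a'))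 (toHeckeCharacter L lam') ((isOscillatorChar_toHeckeCharacter_iff lam').mpr hlam') (borelPlaceMeasure L))) (isSymm_TW (Fp L) a') (JW_eq (Fp L) L a')) (by -- `2 ≤ n'` (§D.1 «rank n ≥ 2»); the assembler's proof argument here is `two_le_of_finTwo_equiv e₁`
          have h := Fintype.card_congr e₁
          simp only [Fintype.card_prod, Fintype.card_fin, mul_one] at h
          omega)
        (localMu L (toHeckeCharacter L lam')) (fun v x => norm_localMu L (toHeckeCharacter L lam') v (isUnitary_toHeckeCharacter L lam') x)
        (continuous_localMu L (toHeckeCharacter L lam'))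
        (fun v t => localMu_toLocalRing_eq_one_iff L (toHeckeCharacter L lam') v ((isOscillatorChar_toHeckeCharacter_iff lam').mpr hlam') t)
        χ v).S.scalar
              (localLemD1DataAtV₂ (Fp L) L (IsCMField.complexConj L) 2 e₁ (Matrix.diagonal dV) (complexConj_imagUnit L)
        (imagUnit_ne_zero L) (imagUnit_mul_self L) (realDiagonal_isSymm L dV hdV) (isUnit_det_realDiagonal L dV hdV hdV0)
        (realDiagonal_map L dV hdV).symm a' (congrW L e₁ dV hdV (lineW L (TW (Fp L) a')) (complexConj_lineW L (TW (Fp L) a')) (realDiagonal_lineW L (TW (Fp L) a')) (diagonal_lineW L (TW (Fp L) a') (JW_eq (Fp L) L a')) (undoubledSplittings L e₁ dV hdV hdV0 (lineW L (TW (Fp L) a')) (complexConj_lineW L (TW (Fp L) a')) (lineW_ne_zero L (TW (Fp L) a') (isUnit_det_TW (Fp L) a')) (toHeckeCharacter L lam') (borelPlaceMeasure L) (cmFinLocalFamily L e₁ dV hdV hdV0 (lineW L (TW (Fp L) a')) (complexConj_lineW L (TW (Fp L) a')) (lineW_ne_zero L (TW (Fp L) a') (isUnit_det_TW (Fp L)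 a')) (toHeckeCharacter L lam') ((isOscillatorChar_toHeckeCharacter_iff lam').mpr hlam') (borelPlaceMeasure L))) (isSymm_TW (Fp L) a') (JW_eq (Fp L) L a')) (by -- `2 ≤ n'` (§D.1 «rank n ≥ 2»); the assembler's proof argument here is `two_le_of_finTwo_equiv e₁`
          have h := Fintype.card_congr e₁
          simp only [Fintype.card_prod, Fintype.card_fin, mul_one] at h
          omega)
        (localMu L (toHeckeCharacter L lam')) (fun v x => norm_localMu L (toHeckeCharacter L lam') v (isUnitary_toHeckeCharacter L lam') x)
        (continuous_localMu L (toHeckeCharacter L lam'))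
        (fun v t => localMu_toLocalRing_eq_one_iff L (toHeckeCharacter L lam') v ((isOscillatorChar_toHeckeCharacter_iff lam').mpr hlam') t)
        χ v).chi) ↔
          localCharOfCenter (Fp L) L (IsCMField.complexConj L) (JW (Fp L) L a') (JW_apply_ne_zero (Fp L) L a') χ.1 v = χ₀) :=
  exists_vanishing_localCharOfCenter_of_isField_of_hilbertSymbol (Fp L) L (IsCMField.complexConj L) e₁ (Matrix.diagonal dV)
    (complexConj_imagUnit L) (imagUnit_ne_zero L) (imagUnit_mul_self L) (realDiagonal_isSymm L dV hdV) (isUnit_det_realDiagonal L dV hdV hdV0)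
    (realDiagonal_map L dV hdV).symm
    (fun i => Units.mk0 (⟨dV i, (IsCMField.complexConj_eq_self_iff (K := L) (dV i)).1 (hdV i)⟩ : Fp L) (fun h => hdV0 i (congrArg Subtype.val h)))
    rfl a' _ _ _ _ _ _ v (isField_localRing_cm_of_forall_smul_eq L v hv) hH

-- as above: 2× the default budget for the CM package terms
set_option maxHeartbeats 400000 in
/-- **[Liu2021, Lem. D.1 (1)] on the rank-2 CM θ-package at an ANISOTROPIC NON-SPLIT place — EXACTLY ONE vanishing central character**, the guard stated
in the datum's own currency `(…).IsAnisotropic` (per `χ`, a `χ`-free condition: ★ `LemD1Data.isAnisotropic_iff_not_isIsotropic` +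
★ `not_isIsotropic_standingData_iff_hilbertSymbol_eq_neg_one` turn it into `(δ², −dV₀dV₁)_v = −1`).  What the letter L1ns still owes at such a place is only
the IDENTIFICATION of `χ₀` with «`χ̌_v = μ_v²`».
[cite: Liu2021, App. D Lemma D.1 (1) (p. 125, l. 5229); proof l. 5245 (p. 126)] [cite: MoeglinVignerasWaldspurger1987, Chap. 3 §IV.4 Théorème principal] -/
theorem exists_vanishing_localCharOfCenter_cm_of_isAnisotropic
    (L : Type) [Field L] [NumberField L] [IsCMField L]
      (dV : Fin 2 → L) (hdV : ∀ i, IsCMField.complexConj L (dV i) = dV i) (hdV0 : ∀ i, dV i ≠ 0)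
      {n' : ℕ} (e₁ : Fin 2 × Fin 1 ≃ Fin n') (a' : (↥(maximalRealSubfield L))ˣ)
      (lam' : Literature.NumberTheory.Automorphic.IdeleClassGroup L →ₜ* Circle) (hlam' : IsConjugateSymplectic L lam')
      (v : HeightOneSpectrum (𝓞 ↥(maximalRealSubfield L)))
    (hv : ∀ w : UnitaryGroup.PlacesOver L v, IsCMField.complexConj L • (w : HeightOneSpectrum (𝓞 L)) = w) :
    ∃ χ₀ : UnitaryGroup.localPi L (IsCMField.complexConj L) 1 (JW (Fp L) L a') v →* ℂˣ,
      IsOpen (χ₀.ker : Set (UnitaryGroup.localPi L (IsCMField.complexConj L) 1 (JW (Fp L) L a') v)) ∧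
      ∀ χ : Chi (↥(maximalRealSubfield L)) L (IsCMField.complexConj L),
        (localLemD1DataAtV₂ (Fp L) L (IsCMField.complexConj L) 2 e₁ (Matrix.diagonal dV) (complexConj_imagUnit L)
        (imagUnit_ne_zero L) (imagUnit_mul_self L) (realDiagonal_isSymm L dV hdV) (isUnit_det_realDiagonal L dV hdV hdV0)
        (realDiagonal_map L dV hdV).symm a' (congrW L e₁ dV hdV (lineW L (TW (Fp L) a')) (complexConj_lineW L (TW (Fp L) a')) (realDiagonal_lineW L (TW (Fp L) a')) (diagonal_lineW L (TW (Fp L) a') (JW_eq (Fp L) L a')) (undoubledSplittings L e₁ dV hdV hdV0 (lineW L (TW (Fp L) a')) (complexConj_lineW L (TW (Fp L) a')) (lineW_ne_zero L (TW (Fp L) a') (isUnit_det_TW (Fp L) a')) (toHeckeCharacter L lam') (borelPlaceMeasure L) (cmFinLocalFamily L e₁ dV hdV hdV0 (lineW L (TW (Fp L) a')) (complexConj_lineW L (TW (Fp L) a')) (lineW_ne_zero L (TW (Fp L) a') (isUnit_det_TW (Fp L) a')) (toHeckeCharacter L lam') ((isOscillatorChar_toHeckeCharacter_iff lam').mpr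 hlam') (borelPlaceMeasure L))) (isSymm_TW (Fp L) a') (JW_eq (Fp L) L a')) (by -- `2 ≤ n'` (§D.1 «rank n ≥ 2»); the assembler's proof argument here is `two_le_of_finTwo_equiv e₁`
          have h := Fintype.card_congr e₁
          simp only [Fintype.card_prod, Fintype.card_fin, mul_one] at h
          omega)
        (localMu L (toHeckeCharacter L lam')) (fun v x => norm_localMu L (toHeckeCharacter L lam') v (isUnitary_toHeckeCharacter L lam') x)
        (continuous_localMu L (toHeckeCharacter L lam'))
        (fun v t => localMu_toLocalRing_eq_one_iff L (toHeckeCharacter L lam') v ((isOscillatorChar_toHeckeCharacter_iff lam').mpr hlam') t)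
        χ v).IsAnisotropic →
        (Subsingleton (SchwartzBruhat (Fin n' → v.adicCompletion (Fp L)) ⧸
            augmentation (localLemD1DataAtV₂ (Fp L) L (IsCMField.complexConj L) 2 e₁ (Matrix.diagonal dV) (complexConj_imagUnit L)
        (imagUnit_ne_zero L) (imagUnit_mul_self L) (realDiagonal_isSymm L dV hdV) (isUnit_det_realDiagonal L dV hdV hdV0)
        (realDiagonal_map L dV hdV).symm a' (congrW L e₁ dV hdV (lineW L (TW (Fp L) a')) (complexConj_lineW L (TW (Fp L) a')) (realDiagonal_lineW L (TW (Fp L) a')) (diagonal_lineW L (TW (Fp L) a') (JW_eq (Fp L) L a')) (undoubledSplittings L e₁ dV hdV hdV0 (lineW L (TW (Fp L) a')) (complexConj_lineW L (TW (Fp L) a')) (lineW_ne_zero L (TW (Fp L) a') (isUnit_det_TW (Fp L) a')) (toHeckeCharacter L lam') (borelPlaceMeasure L) (cmFinLocalFamily L e₁ dV hdV hdV0 (lineW L (TW (Fp L) a')) (complexConj_lineW L (TW (Fp L) a')) (lineW_ne_zero L (TW (Fp L) a') (isUnit_det_TW (Fp L) a')) (toHeckeCharacter L lam') ((isOscillatorChar_toHeckeCharacter_iff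 lam').mpr hlam') (borelPlaceMeasure L))) (isSymm_TW (Fp L) a') (JW_eq (Fp L) L a')) (by -- `2 ≤ n'` (§D.1 «rank n ≥ 2»); the assembler's proof argument here is `two_le_of_finTwo_equiv e₁`
          have h := Fintype.card_congr e₁
          simp only [Fintype.card_prod, Fintype.card_fin, mul_one] at h
          omega)
        (localMu L (toHeckeCharacter L lam')) (fun v x => norm_localMu L (toHeckeCharacter L lam') v (isUnitary_toHeckeCharacter L lam') x)
        (continuous_localMu L (toHeckeCharacter L lam'))
        (fun v t => localMu_toLocalRing_eq_one_iff L (toHeckeCharacter L lam') v ((isOscillatorChar_toHeckeCharacter_iff lam').mpr hlam') t)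
        χ v).omega
              (localLemD1DataAtV₂ (Fp L) L (IsCMField.complexConj L) 2 e₁ (Matrix.diagonal dV) (complexConj_imagUnit L)
        (imagUnit_ne_zero L) (imagUnit_mul_self L) (realDiagonal_isSymm L dV hdV) (isUnit_det_realDiagonal L dV hdV hdV0)
        (realDiagonal_map L dV hdV).symm a' (congrW L e₁ dV hdV (lineW L (TW (Fp L) a')) (complexConj_lineW L (TW (Fp L) a')) (realDiagonal_lineW L (TW (Fp L) a')) (diagonal_lineW L (TW (Fp L) a') (JW_eq (Fp L) L a')) (undoubledSplittings L e₁ dV hdV hdV0 (lineW L (TW (Fp L) a')) (complexConj_lineW L (TW (Fp L) a')) (lineW_ne_zero L (TW (Fp L) a') (isUnit_det_TW (Fp L) a')) (toHeckeCharacter L lam') (borelPlaceMeasure L) (cmFinLocalFamily L e₁ dV hdV hdV0 (lineW L (TW (Fp L) a')) (complexConj_lineW L (TW (Fp L) a')) (lineW_ne_zero L (TW (Fp L) a') (isUnit_det_TW (Fp L) a')) (toHeckeCharacter L lam') ((isOscillatorChar_toHeckeCharacter_iff lam').mpr hlam') (borelPlaceMeasure L))) (isSymm_TW (Fp L) a')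 (JW_eq (Fp L) L a')) (by -- `2 ≤ n'` (§D.1 «rank n ≥ 2»); the assembler's proof argument here is `two_le_of_finTwo_equiv e₁`
          have h := Fintype.card_congr e₁
          simp only [Fintype.card_prod, Fintype.card_fin, mul_one] at h
          omega)
        (localMu L (toHeckeCharacter L lam')) (fun v x => norm_localMu L (toHeckeCharacter L lam') v (isUnitary_toHeckeCharacter L lam') x)
        (continuous_localMu L (toHeckeCharacter L lam'))
        (fun v t => localMu_toLocalRing_eq_one_iff L (toHeckeCharacter L lam') v ((isOscillatorChar_toHeckeCharacter_iff lam').mpr hlam') t)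
        χ v).S.scalar
              (localLemD1DataAtV₂ (Fp L) L (IsCMField.complexConj L) 2 e₁ (Matrix.diagonal dV) (complexConj_imagUnit L)
        (imagUnit_ne_zero L) (imagUnit_mul_self L) (realDiagonal_isSymm L dV hdV) (isUnit_det_realDiagonal L dV hdV hdV0)
        (realDiagonal_map L dV hdV).symm a' (congrW L e₁ dV hdV (lineW L (TW (Fp L) a')) (complexConj_lineW L (TW (Fp L) a')) (realDiagonal_lineW L (TW (Fp L) a')) (diagonal_lineW L (TW (Fp L) a') (JW_eq (Fp L) L a')) (undoubledSplittings L e₁ dV hdV hdV0 (lineW L (TW (Fp L) a')) (complexConj_lineW L (TW (Fp L) a')) (lineW_ne_zero L (TW (Fp L) a') (isUnit_det_TW (Fp L) a')) (toHeckeCharacter L lam') (borelPlaceMeasure L) (cmFinLocalFamily L e₁ dV hdV hdV0 (lineW L (TW (Fp L) a')) (complexConj_lineW L (TW (Fp L) a')) (lineW_ne_zero L (TW (Fp L) a') (isUnit_det_TW (Fp L) a')) (toHeckeCharacter L lam') ((isOscillatorChar_toHeckeCharacter_iff lam').mpr hlam') (borelPlaceMeasure L))) (isSymm_TW (Fp L)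 a') (JW_eq (Fp L) L a')) (by -- `2 ≤ n'` (§D.1 «rank n ≥ 2»); the assembler's proof argument here is `two_le_of_finTwo_equiv e₁`
          have h := Fintype.card_congr e₁
          simp only [Fintype.card_prod, Fintype.card_fin, mul_one] at h
          omega)
        (localMu L (toHeckeCharacter L lam')) (fun v x => norm_localMu L (toHeckeCharacter L lam') v (isUnitary_toHeckeCharacter L lam') x)
        (continuous_localMu L (toHeckeCharacter L lam'))
        (fun v t => localMu_toLocalRing_eq_one_iff L (toHeckeCharacter L lam') v ((isOscillatorChar_toHeckeCharacter_iff lam').mpr hlam') t)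
        χ v).chi) ↔
          localCharOfCenter (Fp L) L (IsCMField.complexConj L) (JW (Fp L) L a') (JW_apply_ne_zero (Fp L) L a') χ.1 v = χ₀) :=
  exists_vanishing_localCharOfCenter_of_isField (Fp L) L (IsCMField.complexConj L) e₁ (Matrix.diagonal dV)
    (complexConj_imagUnit L) (imagUnit_ne_zero L) (imagUnit_mul_self L) (realDiagonal_isSymm L dV hdV) (isUnit_det_realDiagonal L dV hdV hdV0)
    (realDiagonal_map L dV hdV).symm
    (fun i => Units.mk0 (⟨dV i, (IsCMField.complexConj_eq_self_iff (K := L) (dV i)).1 (hdV i)⟩ : Fp L) (fun h => hdV0 i (congrArg Subtype.val h)))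
    rfl a' _ _ _ _ _ _ v (isField_localRing_cm_of_forall_smul_eq L v hv)

end CM

end Literature.NumberTheory.Automorphic.Liu2021.Def411WeilCarriers

/-! ## ED. 2 (B-p04 (g43), 2026-09-02, on «LD1» LD1-p02 (g3)'s word) — (R) EXPORTED IN THE LOCAL COINVARIANT CURRENCY

ED. 1 exports (R) through the datum's `χ_v`-quotient at GLOBAL `χ : Chi`; a LOCAL pin letter («the character `z = x/x̄ ↦ μ_v(x)²` of
`U(⟨a′⟩)(L⁺_v)` kills the `χ′`-coinvariants») needs (R) for ALL unitary continuous characters `χ′` of the local centre — the internal `hmain`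
of ED. 1.  ED. 2 states it: generic (`…_of_isField_of_hilbertSymbol`, guard `(d, −t₀t₁)_v = −1`; `…_of_isField_of_not_isIsotropic`, guard
«`(E_v², J_V)` not isotropic» in the standing-data currency) and on the letter's CM θ-package (`…_cm_of_hilbertSymbol`, `…_cm_of_not_isIsotropic`). -/

namespace Literature.NumberTheory.Automorphic.Liu2021.Def411WeilCarriers

open Literature.NumberTheory.GelbartRogawski1991 Literature.NumberTheory.GelbartRogawski1991.UnitaryDualPair
open Literature.NumberTheory.GelbartRogawski1991.UnitaryDualPair.WeilCoinv
open Literature.NumberTheory.GelbartRogawski1991.UnitaryDualPair.LocalSplitting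

section AtVLocal

variable (F E : Type) [Field F] [NumberField F] [Field E] [NumberField E] [Algebra F E]
variable (c : E ≃ₐ[F] E) {n : ℕ} (e : Fin 2 × Fin 1 ≃ Fin n)
variable (JV : Matrix (Fin 2) (Fin 2) E) {TV : Matrix (Fin 2) (Fin 2) F}
variable [Algebra.IsQuadraticExtension F E] {δ : E} (hcδ : c δ = -δ) (hδ : δ ≠ 0) {d : F} (hd : δ * δ = algebraMap F E d)

/-- **(R) in the LOCAL COINVARIANT currency, GENERIC splitting family.**  For a rank-2 splitting family `𝓢` over the diagonal frame
`T_V = diag(t₀, t₁)` and the line `(a)` (any enumeration `e : Fin 2 × Fin 1 ≃ Fin n`), at a place `v` with `E_v` a FIELD and `(d, −t₀t₁)_v = −1`: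
there is a character `χ₀` of the centre line `U(J_W)(F_v)` (`J_W = (a)`) with open kernel such that for EVERY unitary continuous character `χ′` of
`U(J_W)(F_v)`, the `χ′`-coinvariants of `ω_v = 𝓢.omegaLoc v` along the local centre `z ↦ z·1` are non-zero `⟺ χ′ ≠ χ₀`
(★ `rankOne_theta_anisotropicPlane_dichotomy_centre` at `𝓢.s v`, §1's Gram junction; `𝓢.omegaLoc v = toRep ∘ 𝓢.s v` by `rfl`).
[cite: MoeglinVignerasWaldspurger1987, Chap. 3 §IV.4 Théorème principal; §IV.2] [cite: Liu2021, App. D Lemma D.1 (1) (p. 125, l. 5229)] -/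
theorem exists_vanishing_coinv_localCenter_of_isField_of_hilbertSymbol (hV : TV.IsSymm) (hVd : IsUnit TV.det)
    (hJV : JV = TV.map (algebraMap F E)) (t : Fin 2 → Fˣ) (hTV : TV = Matrix.diagonal fun i => (t i : F)) (a : Fˣ)
    (𝓢 : LocalSplitting.FinLocalSplittings F E c n hcδ hδ hd (gram F e TV (TW F a)) (isSymm_gram F e hV (isSymm_TW F a))
      (reindex_kronecker_eq_gram_map F E e hJV (JW_eq F E a)))
    (v : HeightOneSpectrum (𝓞 F)) (hf : IsField (LocalRing E v))
    (hH : hilbertSymbol (v.adicCompletion F) (algebraMap F _ d) (algebraMap F _ (-((t 0 : F) * (t 1 : F)))) = -1) :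
    ∃ χ₀ : localPi E c 1 (JW F E a) v →* ℂˣ, IsOpen (χ₀.ker : Set (localPi E c 1 (JW F E a) v)) ∧
      ∀ χ' : localPi E c 1 (JW F E a) v →* ℂˣ, (∀ u, ‖((χ' u : ℂˣ) : ℂ)‖ = 1) → (Continuous fun u => ((χ' u : ℂˣ) : ℂ)) →
        (Nontrivial (TwistedCoinv.Coinv
            (show Representation ℂ (localPi E c 1 (JW F E a) v) (SchwartzBruhat (Fin n → v.adicCompletion F)) from
              (𝓢.omegaLoc v).comp (localCenter E c n (Matrix.reindex e e (JV ⊗ₖ JW F E a)) (JW F E a) (JW_apply_ne_zero F E a) v))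
            χ') ↔ χ' ≠ χ₀) := by
  -- `n = 2`, `T_V = diag(t)`
  obtain rfl : n = 2 := by
    have h := Fintype.card_congr e
    simp only [Fintype.card_prod, Fintype.card_fin, mul_one] at h
    omega
  subst hTV
  -- the plane `(a t_{e⁻¹0}) ⊕ (a t_{e⁻¹1})` and its class (as in §2)
  have hT := gram_diagonal_units_TW_eq_finSum F e t a
  have hTT' := TW_mul_eq_ratio_smul F a (t (e.symm 0).1) (t (e.symm 1).1)
  have hclass : hilbertSymbol (v.adicCompletion F) ((-((t (e.symm 1).1 * (t (e.symm 0).1)⁻¹ : Fˣ) : F)⁻¹ : F) : v.adicCompletion F)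
      ((d : F) : v.adicCompletion F) = -1 := by
    have h0 : ((t (e.symm 1).1 : Fˣ) : F) ≠ 0 := (t (e.symm 1).1).ne_zero
    have hx : (-((t (e.symm 1).1 * (t (e.symm 0).1)⁻¹ : Fˣ) : F)⁻¹ : F) =
        -((t 0 : F) * (t 1 : F)) * (((t (e.symm 1).1 : F))⁻¹) ^ 2 := by
      rw [← units_enum_mul_eq F e t, Units.val_mul, Units.val_inv_eq_inv_val]
      field_simp
    have hx' : ((-((t (e.symm 1).1 * (t (e.symm 0).1)⁻¹ : Fˣ) : F)⁻¹ : F) : v.adicCompletion F) =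
        algebraMap F (v.adicCompletion F) (-((t 0 : F) * (t 1 : F))) * (algebraMap F (v.adicCompletion F) ((t (e.symm 1).1 : F)⁻¹)) ^ 2 := by
      rw [← map_pow, ← map_mul, ← hx]; rfl
    rw [Literature.NumberTheory.QuadraticForms.hilbertSymbol_comm, hx',
      Literature.NumberTheory.QuadraticForms.hilbertSymbol_mul_sq_right _ _ ((map_ne_zero _).2 (inv_ne_zero h0))]
    exact hH
  obtain ⟨χ₀, hχ₀o, hmain⟩ := rankOne_theta_anisotropicPlane_dichotomy_centre F E c hcδ hδ hd v (isSymm_TW F (a * t (e.symm 0).1))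
    (isSymm_TW F (a * t (e.symm 1).1)) (isUnit_det_TW F (a * t (e.symm 0).1)) (isUnit_det_TW F (a * t (e.symm 1).1))
    (t (e.symm 1).1 * (t (e.symm 0).1)⁻¹) hTT' (JW_eq F E (a * t (e.symm 0).1)) (JW_eq F E (a * t (e.symm 1).1)) hT
    (isSymm_gram F e hV (isSymm_TW F a)) (reindex_kronecker_eq_gram_map F E e hJV (JW_eq F E a)) (𝓢.s v) (𝓢.proj_s v)
    (JW_apply_ne_zero F E (a * t (e.symm 0).1)) (JW_apply_ne_zero F E a) hf (𝓢.smooth v) hclass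
  exact ⟨χ₀, hχ₀o, hmain⟩

/-- **(R) in the LOCAL COINVARIANT currency, GENERIC, guard «`(E_v², J_V)` is NOT isotropic»** (standing-data currency, any proofs
`hJh`, `hJdet`; ★ `not_isIsotropic_standingData_iff_hilbertSymbol_eq_neg_one` converts it to `(d, −t₀t₁)_v = −1`).
[cite: MoeglinVignerasWaldspurger1987, Chap. 3 §IV.4 Théorème principal] [cite: Liu2021, App. D Lemma D.1 (1) (p. 125, l. 5229)] -/
theorem exists_vanishing_coinv_localCenter_of_isField_of_not_isIsotropic (hV : TV.IsSymm) (hVd : IsUnit TV.det)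
    (hJV : JV = TV.map (algebraMap F E)) (t : Fin 2 → Fˣ) (hTV : TV = Matrix.diagonal fun i => (t i : F)) (a : Fˣ)
    (𝓢 : LocalSplitting.FinLocalSplittings F E c n hcδ hδ hd (gram F e TV (TW F a)) (isSymm_gram F e hV (isSymm_TW F a))
      (reindex_kronecker_eq_gram_map F E e hJV (JW_eq F E a)))
    (v : HeightOneSpectrum (𝓞 F)) (hf : IsField (LocalRing E v))
    {hJh : (JV.map c)ᵀ = JV} {hJdet : JV.det ≠ 0}
    (hani : ¬ LemD1.IsIsotropic (LemD1OfPlace.standingData E v c 2 JV hcδ hδ le_rfl hJh hJdet)) :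
    ∃ χ₀ : localPi E c 1 (JW F E a) v →* ℂˣ, IsOpen (χ₀.ker : Set (localPi E c 1 (JW F E a) v)) ∧
      ∀ χ' : localPi E c 1 (JW F E a) v →* ℂˣ, (∀ u, ‖((χ' u : ℂˣ) : ℂ)‖ = 1) → (Continuous fun u => ((χ' u : ℂˣ) : ℂ)) →
        (Nontrivial (TwistedCoinv.Coinv
            (show Representation ℂ (localPi E c 1 (JW F E a) v) (SchwartzBruhat (Fin n → v.adicCompletion F)) from
              (𝓢.omegaLoc v).comp (localCenter E c n (Matrix.reindex e e (JV ⊗ₖ JW F E a)) (JW F E a) (JW_apply_ne_zero F E a) v))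
            χ') ↔ χ' ≠ χ₀) := by
  have hJ' : JV = (Matrix.diagonal fun i => (t i : F)).map (algebraMap F E) := by rw [hJV, hTV]
  exact exists_vanishing_coinv_localCenter_of_isField_of_hilbertSymbol F E c e JV hcδ hδ hd hV hVd hJV t hTV a 𝓢 v hf
    ((LemD1OfPlace.not_isIsotropic_standingData_iff_hilbertSymbol_eq_neg_one E v c hcδ hδ (fun i => (t i : F)) hJ' hJh hJdet hd
      (fun i => (t i).ne_zero)).1 hani)

end AtVLocal

section CMLocal

open NumberField.mixedEmbedding NumberField.InfinitePlace
open Literature.NumberTheory.GaloisRepresentations Literature.RepresentationTheory.HarrisKudlaSweet1996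
open Literature.NumberTheory.Automorphic.IdeleClassGroup Literature.RepresentationTheory.Liu2021
open Literature.NumberTheory.Automorphic.Liu2021.Def411WeilCarriersDoubling
open Literature.NumberTheory.GelbartRogawski1991.GRConstruction

-- unifying the letter's CM package terms with the generic binders: 2× the default budget
set_option maxHeartbeats 400000 in
/-- **(R) in the LOCAL COINVARIANT currency on the rank-2 CM θ-package `𝓢_{λ′,a′}` at a NON-SPLIT place with `(δ², −dV₀dV₁)_v = −1`.**
For every CM field `L`, real non-zero frame `dV`, enumeration `e₁`, line `a′`, conjugate-symplectic `λ′`, and finite place `v` of `L⁺` NON-SPLIT in `L`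
with `(δ², −dV₀dV₁)_v = −1`: there is `χ₀` (open kernel) on `U(J_W)(L⁺_v)` (`J_W = (a′)`) such that for EVERY unitary continuous character `χ′` of
`U(J_W)(L⁺_v)`: `Coinv_{χ′}(ω_{𝓢_{λ′,a′},v} ∘ (z ↦ z·1)) ≠ 0 ⟺ χ′ ≠ χ₀`.
[cite: Liu2021, App. D Lemma D.1 (1) (p. 125, l. 5229); proof l. 5245 (p. 126)] [cite: MoeglinVignerasWaldspurger1987, Chap. 3 §IV.4 Théorème principal] -/
theorem exists_vanishing_coinv_localCenter_cm_of_hilbertSymbol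
    (L : Type) [Field L] [NumberField L] [IsCMField L]
      (dV : Fin 2 → L) (hdV : ∀ i, IsCMField.complexConj L (dV i) = dV i) (hdV0 : ∀ i, dV i ≠ 0)
      {n' : ℕ} (e₁ : Fin 2 × Fin 1 ≃ Fin n') (a' : (↥(maximalRealSubfield L))ˣ)
      (lam' : Literature.NumberTheory.Automorphic.IdeleClassGroup L →ₜ* Circle) (hlam' : IsConjugateSymplectic L lam')
      (v : HeightOneSpectrum (𝓞 ↥(maximalRealSubfield L)))
    (hv : ∀ w : UnitaryGroup.PlacesOver L v, IsCMField.complexConj L • (w : HeightOneSpectrum (𝓞 L)) = w)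
    (hH : hilbertSymbol (v.adicCompletion (Fp L)) (algebraMap (Fp L) _ (imagUnitSq L))
      (algebraMap (Fp L) _ (-((⟨dV 0, (IsCMField.complexConj_eq_self_iff (K := L) (dV 0)).1 (hdV 0)⟩ : Fp L) * (⟨dV 1, (IsCMField.complexConj_eq_self_iff (K := L) (dV 1)).1 (hdV 1)⟩ : Fp L)))) = -1) :
    ∃ χ₀ : UnitaryGroup.localPi L (IsCMField.complexConj L) 1 (JW (Fp L) L a') v →* ℂˣ,
      IsOpen (χ₀.ker : Set (UnitaryGroup.localPi L (IsCMField.complexConj L) 1 (JW (Fp L) L a') v)) ∧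
      ∀ χ' : UnitaryGroup.localPi L (IsCMField.complexConj L) 1 (JW (Fp L) L a') v →* ℂˣ,
        (∀ u, ‖((χ' u : ℂˣ) : ℂ)‖ = 1) → (Continuous fun u => ((χ' u : ℂˣ) : ℂ)) →
        (Nontrivial (TwistedCoinv.Coinv
            (show Representation ℂ (UnitaryGroup.localPi L (IsCMField.complexConj L) 1 (JW (Fp L) L a') v)
                (SchwartzBruhat (Fin n' → v.adicCompletion (Fp L))) from
              ((congrW L e₁ dV hdV (lineW L (TW (Fp L) a')) (complexConj_lineW L (TW (Fp L) a')) (realDiagonal_lineW L (TW (Fp L) a')) (diagonal_lineW L (TW (Fp L) a') (JW_eq (Fp L) L a')) (undoubledSplittings L e₁ dV hdV hdV0 (lineW L (TW (Fp L) a')) (complexConj_lineW L (TW (Fp L) a')) (lineW_ne_zero L (TW (Fp L) a') (isUnit_det_TW (Fp L) a')) (toHeckeCharacter L lam') (borelPlaceMeasure L) (cmFinLocalFamily L e₁ dV hdV hdV0 (lineW L (TW (Fp L) a')) (complexConj_lineW L (TW (Fp L) a')) (lineW_ne_zero L (TW (Fp L) a') (isUnit_det_TW (Fp L) a')) (toHeckeCharacter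 L lam') ((isOscillatorChar_toHeckeCharacter_iff lam').mpr hlam') (borelPlaceMeasure L))) (isSymm_TW (Fp L) a') (JW_eq (Fp L) L a')).omegaLoc v).comp
                (UnitaryGroup.localCenter L (IsCMField.complexConj L) n' (Matrix.reindex e₁ e₁ (Matrix.diagonal dV ⊗ₖ JW (Fp L) L a'))
                  (JW (Fp L) L a') (JW_apply_ne_zero (Fp L) L a') v))
            χ') ↔ χ' ≠ χ₀) :=
  exists_vanishing_coinv_localCenter_of_isField_of_hilbertSymbol (Fp L) L (IsCMField.complexConj L) e₁ (Matrix.diagonal dV)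
    (complexConj_imagUnit L) (imagUnit_ne_zero L) (imagUnit_mul_self L) (realDiagonal_isSymm L dV hdV) (isUnit_det_realDiagonal L dV hdV hdV0)
    (realDiagonal_map L dV hdV).symm
    (fun i => Units.mk0 (⟨dV i, (IsCMField.complexConj_eq_self_iff (K := L) (dV i)).1 (hdV i)⟩ : Fp L) (fun h => hdV0 i (congrArg Subtype.val h)))
    rfl a' _ v (isField_localRing_cm_of_forall_smul_eq L v hv) hH

-- as above
set_option maxHeartbeats 400000 in
/-- **(R) in the LOCAL COINVARIANT currency on the rank-2 CM θ-package, guard «`(L_v², diag dV)` is NOT isotropic»** (standing-data currency,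
any proofs `hJh`, `hJdet`, rank witness `le_rfl`).
[cite: Liu2021, App. D Lemma D.1 (1) (p. 125, l. 5229); proof l. 5245 (p. 126)] [cite: MoeglinVignerasWaldspurger1987, Chap. 3 §IV.4 Théorème principal] -/
theorem exists_vanishing_coinv_localCenter_cm_of_not_isIsotropic
    (L : Type) [Field L] [NumberField L] [IsCMField L]
      (dV : Fin 2 → L) (hdV : ∀ i, IsCMField.complexConj L (dV i) = dV i) (hdV0 : ∀ i, dV i ≠ 0)
      {n' : ℕ} (e₁ : Fin 2 × Fin 1 ≃ Fin n') (a' : (↥(maximalRealSubfield L))ˣ)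
      (lam' : Literature.NumberTheory.Automorphic.IdeleClassGroup L →ₜ* Circle) (hlam' : IsConjugateSymplectic L lam')
      (v : HeightOneSpectrum (𝓞 ↥(maximalRealSubfield L)))
    (hv : ∀ w : UnitaryGroup.PlacesOver L v, IsCMField.complexConj L • (w : HeightOneSpectrum (𝓞 L)) = w)
    {hJh : ((Matrix.diagonal dV).map (IsCMField.complexConj L))ᵀ = Matrix.diagonal dV} {hJdet : (Matrix.diagonal dV).det ≠ 0}
    (hani : ¬ LemD1.IsIsotropic (LemD1OfPlace.standingData L v (IsCMField.complexConj L) 2 (Matrix.diagonal dV)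
      (complexConj_imagUnit L) (imagUnit_ne_zero L) le_rfl hJh hJdet)) :
    ∃ χ₀ : UnitaryGroup.localPi L (IsCMField.complexConj L) 1 (JW (Fp L) L a') v →* ℂˣ,
      IsOpen (χ₀.ker : Set (UnitaryGroup.localPi L (IsCMField.complexConj L) 1 (JW (Fp L) L a') v)) ∧
      ∀ χ' : UnitaryGroup.localPi L (IsCMField.complexConj L) 1 (JW (Fp L) L a') v →* ℂˣ,
        (∀ u, ‖((χ' u : ℂˣ) : ℂ)‖ = 1) → (Continuous fun u => ((χ' u : ℂˣ) : ℂ)) →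
        (Nontrivial (TwistedCoinv.Coinv
            (show Representation ℂ (UnitaryGroup.localPi L (IsCMField.complexConj L) 1 (JW (Fp L) L a') v)
                (SchwartzBruhat (Fin n' → v.adicCompletion (Fp L))) from
              ((congrW L e₁ dV hdV (lineW L (TW (Fp L) a')) (complexConj_lineW L (TW (Fp L) a')) (realDiagonal_lineW L (TW (Fp L) a')) (diagonal_lineW L (TW (Fp L) a') (JW_eq (Fp L) L a')) (undoubledSplittings L e₁ dV hdV hdV0 (lineW L (TW (Fp L) a')) (complexConj_lineW L (TW (Fp L) a')) (lineW_ne_zero L (TW (Fp L) a') (isUnit_det_TW (Fp L) a')) (toHeckeCharacter L lam') (borelPlaceMeasure L) (cmFinLocalFamily L e₁ dV hdV hdV0 (lineW L (TW (Fp L) a')) (complexConj_lineW L (TW (Fp L) a')) (lineW_ne_zero L (TW (Fp L) a') (isUnit_det_TW (Fp L) a')) (toHeckeCharacter L lam') ((isOscillatorChar_toHeckeCharacter_iff lam').mpr hlam') (borelPlaceMeasure L))) (isSymm_TW (Fp L) a') (JW_eq (Fp L) L a')).omegaLoc v).comp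
                (UnitaryGroup.localCenter L (IsCMField.complexConj L) n' (Matrix.reindex e₁ e₁ (Matrix.diagonal dV ⊗ₖ JW (Fp L) L a'))
                  (JW (Fp L) L a') (JW_apply_ne_zero (Fp L) L a') v))
            χ') ↔ χ' ≠ χ₀) :=
  exists_vanishing_coinv_localCenter_of_isField_of_not_isIsotropic (Fp L) L (IsCMField.complexConj L) e₁ (Matrix.diagonal dV)
    (complexConj_imagUnit L) (imagUnit_ne_zero L) (imagUnit_mul_self L) (realDiagonal_isSymm L dV hdV) (isUnit_det_realDiagonal L dV hdV hdV0)
    (realDiagonal_map L dV hdV).symm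
    (fun i => Units.mk0 (⟨dV i, (IsCMField.complexConj_eq_self_iff (K := L) (dV i)).1 (hdV i)⟩ : Fp L) (fun h => hdV0 i (congrArg Subtype.val h)))
    rfl a' _ v (isField_localRing_cm_of_forall_smul_eq L v hv) hani

end CMLocal

end Literature.NumberTheory.Automorphic.Liu2021.Def411WeilCarriers

end
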